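import Literature.AlgebraicGeometry.Motives.JacobianThetaDivisorSubscheme
import Literature.AlgebraicGeometry.Motives.JacobianBrillNoetherLocusDimension
import Literature.AlgebraicGeometry.Motives.JacobianThetaDivisorDimPos
import Literature.AlgebraicGeometry.Motives.CartierDivisorReducedMultiplicityOne
import HarnessLib

/-!
# The prime theta divisor `[W̃_{g−1}(P)]` of a Jacobian

Layer `Literature/AlgebraicGeometry/Motives` (namespaces `….Motives.CartierDivisor`, `….Motives.Jacobian`).  KERNEL ONLY (theorems; no
definition, no named fact, no instance, no `sorry`).  The object studied is the TERM
`CartierDivisor.ofIsEffectiveCartier (primeDivisorIdeal η) (isEffectiveCartier_primeDivisorIdeal_of_isRegular hX h1)` — the effective Cartier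
divisor `[Z]` of a PRIME DIVISOR `Z = cl{η}` (an irreducible closed subset whose generic point `η` has codimension one) on a regular integral
Noetherian scheme `X` (Hartshorne II.6: prime divisors; Prop. 6.11: on a locally factorial scheme Weil divisors are Cartier; ★
`Resolution.isEffectiveCartier_primeDivisorIdeal_of_isRegular`, ★ `Motives/CartierDivisorOfIdealSheaf`); no abbreviation is declared.

* §1 (any regular integral Noetherian `X`) `[Z]` is effective with support `X ∖ X_1 = Z`, ideal sheaf `𝓘_Z = vanishingIdeal Z`, integral closed
  subscheme `Z([Z]) = Z_red`, and every effective Cartier divisor with support `Z` is `≈ a • [Z]`, `a ≥ 1` (★ p765317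
  `exists_sameDivisor_smul_of_support_eq_closure`, re-read against the named term); and the bookkeeping
  `coheight_genericPoint_eq_one_of_topologicalKrullDim`: for `X` of finite type over a field, `dim Z = dim X − 1 ⇒ coheight η_Z = 1`
  (Görtz–Wedhorn I Thm. 5.22 (3): `dim 𝒪_{X,η} + dim cl{η} = dim X`, ★ `Dimension/FibreLocalRingDimension`).
* §2 (the Jacobian `𝒥` of a geometrically irreducible `k`-scheme `C`, base point `P`) with `W̃ := W̃_{dim J − 1}(P)` (★ `Jacobian.brillNoetherLocus`,
  irreducible ★ p765251, closed): GIVEN `h1 : coheight η_{W̃} = 1` — equivalently (`coheight_genericPoint_brillNoetherLocus_eq_one`)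
  `dim W̃ = dim J − 1`, which ★ p766592 supplies whenever SOME Riemann theta divisor exists (`…_of_isRiemannThetaDivisor`) and which Lange's
  Lemma 4.2.1 (ii) asserts unconditionally (not proved here) — **the prime theta divisor `Θ_W := [W̃]` is a Riemann theta divisor with support
  EXACTLY `W̃`, `𝒪_J(−Θ_W) = vanishingIdeal W̃`, `Z(Θ_W)` integral, and every effective divisor with support `W̃` (e.g. any Riemann theta divisor
  after the normalising translation of ★ p766910) is `≈ a • Θ_W`** (`Jacobian.exists_prime_isRiemannThetaDivisor` and the named-term lemmas);
  (ed. 2) `Jacobian.forall_isEffective_eq_one_primeTheta` — HONE: `Θ_W ≈ m • E`, `E ≥ 0`, `m ≥ 1 ⇒ m = 1` (★ `CartierDivisorReducedMultiplicityOne`).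

Use (cell `hodgecm-mathlib`, D-0151; crux HLiu418 = stmt-HodgeConjecture-24832): the OBJECT of interface row VI-7 (#67) ★-typed
`Jacobian.riemann_brillNoetherLocus_isPrincipalPolarizationDivisor` («`W̃_{g−1}` is an effective divisor defining a principal polarisation»): with
this file the row reads «`Θ_W` is ample and `K(Θ_W) = 0`» about a divisor that EXISTS in the tree; `K(Θ_W) = 0` is the road of ★ p767250
(A-p07 (g14)); ampleness (Mumford §6 Application 1) is not addressed here.  Also the principality-free re-key of road (E) (pen ruling #9 (c)
(V7-b)): `h2 : IsPrincipalPolarizationDivisor Θ` ↦ «`Θ ≈ 1 • Θ_W`».  COUNT-NEUTRAL.  HC_CM is proved only modulo the 7 printed citations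
until rung 0 closes; this file moves no book by itself.

## References
* [Hartshorne1977] R. Hartshorne, *Algebraic Geometry* (1977), II.6 (prime divisors, p. 130), Prop. 6.11 and Remark 6.11.2 (pp. 141–142);
  II Ex. 3.20 (d).
* [GortzWedhorn2020] U. Görtz, T. Wedhorn, *Algebraic Geometry I*, 2nd ed. (2020), Thm. 5.22 (3), Thm. 11.40 (2), Remark 11.27 (p. 305).
* [Lange2023AbelianVarietiesComplex] H. Lange, *Abelian Varieties over the Complex Numbers* (2023), §4.2.1 Lemma 4.2.1 (ii) and Cor. 4.2.4.
* [Milne1986JacobianVarieties] J. S. Milne, *Jacobian Varieties*, in Cornell–Silverman (1986), §6 (`Θ = W^{g−1}`, before Thm. 6.6).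
-/

set_option autoImplicit false

noncomputable section

universe u

open CategoryTheory AlgebraicGeometry Order TopologicalSpace

namespace Literature.AlgebraicGeometry.Motives

open Literature.AlgebraicGeometry.Resolution Literature.AlgebraicGeometry.Dimension

/-! ## §1 The effective Cartier divisor of a prime divisor on a regular scheme -/

namespace CartierDivisor

variable {X : Scheme.{u}} [IsIntegral X]

/-- **The support of the Cartier divisor of an invertible ideal sheaf is `V(I)`**: `X ∖ X_1 = Supp I` for `ofIsEffectiveCartier I`
(★ `avoids_ofIsEffectiveCartier_iff`, pointwise). [cite: GortzWedhorn2020, Remark 11.27 (p. 305)] -/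
theorem compl_nonvanishing_one_ofIsEffectiveCartier (I : X.IdealSheafData) (hI : IsEffectiveCartier I) :
    ((ofIsEffectiveCartier I hI).nonvanishing 1)ᶜ = (I.support : Set X) := by
  rw [← (isEffective_ofIsEffectiveCartier I hI).coe_support_idealSheaf, idealSheaf_ofIsEffectiveCartier]

/-- **`V(𝓘_Z)` is integral** for the vanishing ideal sheaf `𝓘_Z = primeDivisorIdeal η` of the irreducible closed set `Z = cl{η}` (radical
ideal sheaf with irreducible support; ★ `Morphisms.isIntegral_subscheme`). [cite: GortzWedhorn2020, Prop. 3.27 (p. 79)] -/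
theorem isIntegral_subscheme_primeDivisorIdeal {Y : Scheme.{u}} (η : Y) : IsIntegral (primeDivisorIdeal η).subscheme := by
  refine Morphisms.isIntegral_subscheme _ (le_antisymm (fun U => ?_) (Scheme.IdealSheafData.le_radical _)) ?_
  · rw [primeDivisorIdeal, Scheme.IdealSheafData.radical_ideal, Scheme.IdealSheafData.vanishingIdeal_ideal]
    exact (PrimeSpectrum.isRadical_vanishingIdeal _).radical_le_iff.mpr le_rfl
  · rw [coe_support_primeDivisorIdeal]
    exact isIrreducible_singleton.closure

section Regular

variable [IsNoetherian X] (hX : Scheme.IsRegular X) {η : X} (h1 : Order.coheight η = 1)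

/-- **The prime divisor `[cl η]` is effective** (its local equations are sections). [cite: Hartshorne1977, II.6 Prop. 6.11 and Remark 6.11.2 (pp. 141–142)] -/
theorem isEffective_prime :
    (ofIsEffectiveCartier (primeDivisorIdeal η) (isEffectiveCartier_primeDivisorIdeal_of_isRegular hX h1)).IsEffective :=
  isEffective_ofIsEffectiveCartier (primeDivisorIdeal η) (isEffectiveCartier_primeDivisorIdeal_of_isRegular hX h1)

/-- **The support of the prime divisor `[cl η]` is `cl{η}`.** [cite: Hartshorne1977, II.6 Prop. 6.11 and Remark 6.11.2 (pp. 141–142)] -/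
theorem compl_nonvanishing_one_prime :
    ((ofIsEffectiveCartier (primeDivisorIdeal η) (isEffectiveCartier_primeDivisorIdeal_of_isRegular hX h1)).nonvanishing 1)ᶜ =
      closure {η} := by
  rw [compl_nonvanishing_one_ofIsEffectiveCartier, coe_support_primeDivisorIdeal]

/-- **`𝒪_X(−[cl η]) = 𝓘_{cl η}`** (★ `idealSheaf_ofIsEffectiveCartier`). [cite: GortzWedhorn2020, Remark 11.27 (p. 305)] -/
theorem idealSheaf_prime :
    (isEffective_prime hX h1).idealSheaf = primeDivisorIdeal η :=
  idealSheaf_ofIsEffectiveCartier (primeDivisorIdeal η) (isEffectiveCartier_primeDivisorIdeal_of_isRegular hX h1)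

/-- **The closed subscheme `Z([cl η])` of the prime divisor is integral** (it is the reduced induced structure on `cl{η}`).
[cite: GortzWedhorn2020, Prop. 3.27 (p. 79)] -/
theorem isIntegral_subscheme_idealSheaf_prime : IsIntegral (isEffective_prime hX h1).idealSheaf.subscheme := by
  rw [idealSheaf_prime hX h1]
  exact isIntegral_subscheme_primeDivisorIdeal η

/-- The underlying set of `Z([cl η])` is `cl{η}`. [cite: GortzWedhorn2020, Remark 11.27 (p. 305)] -/
theorem range_subschemeι_idealSheaf_prime :
    Set.range (isEffective_prime hX h1).idealSheaf.subschemeι = closure {η} := by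
  rw [(isEffective_prime hX h1).range_subschemeι_idealSheaf, compl_nonvanishing_one_prime hX h1]

/-- **Every effective Cartier divisor with support the prime divisor `cl{η}` is a positive multiple of `[cl η]`** (★ p765317
`exists_sameDivisor_smul_of_support_eq_closure`, read against the named term; Hartshorne II.6.11 for one prime divisor).
[cite: Hartshorne1977, II.6 Prop. 6.11 and Remark 6.11.2 (pp. 141–142)] [cite: GortzWedhorn2020, Thm. 11.40 (2)] -/
theorem IsEffective.exists_sameDivisor_smul_prime {D : CartierDivisor X} (hD : D.IsEffective) (hη : (D.nonvanishing 1)ᶜ = closure {η}) :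
    ∃ a : ℕ, 0 < a ∧
      D.SameDivisor (a • ofIsEffectiveCartier (primeDivisorIdeal η) (isEffectiveCartier_primeDivisorIdeal_of_isRegular hX h1)) := by
  obtain ⟨_, a, ha, h⟩ := hD.exists_sameDivisor_smul_of_support_eq_closure hX hη
  exact ⟨a, ha, h⟩

/-- An effective divisor with support `cl{η}` that is not a proper multiple (`D ≈ m • E ⇒ m = 1`) IS the prime divisor `[cl η]` (same divisor).
[cite: Hartshorne1977, II.6 Prop. 6.11 and Remark 6.11.2 (pp. 141–142)] -/
theorem IsEffective.sameDivisor_prime_of_forall_eq_one {D : CartierDivisor X} (hD : D.IsEffective) (hη : (D.nonvanishing 1)ᶜ = closure {η})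
    (hone : ∀ (E : CartierDivisor X) (m : ℕ), 0 < m → D.SameDivisor (m • E) → m = 1) :
    D.SameDivisor (ofIsEffectiveCartier (primeDivisorIdeal η) (isEffectiveCartier_primeDivisorIdeal_of_isRegular hX h1)) :=
  hD.sameDivisor_ofIsEffectiveCartier_primeDivisorIdeal_of_forall_eq_one hX hη hone

end Regular

/-- **`dim Z = dim X − 1 ⇒ coheight η_Z = 1`** for an irreducible closed subset `Z` of an integral scheme `X` locally of finite type over a field
(`dim 𝒪_{X,η} + dim cl{η} = dim X`, Görtz–Wedhorn I Thm. 5.22 (3), ★ `coheight_add_height_eq_topologicalKrullDim`; `dim cl{η} = height η`, ★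
`topologicalKrullDim_eq_height_of_isGenericPoint`). [cite: GortzWedhorn2020, Thm. 5.22 (3)] [cite: Hartshorne1977, II Ex. 3.20 (d)] -/
theorem coheight_genericPoint_eq_one_of_topologicalKrullDim {K : Type u} [Field K] (f : X ⟶ Spec (.of K)) [LocallyOfFiniteType f]
    {Z : Set X} (hZ : IsIrreducible Z) (hcl : IsClosed Z) {n : ℕ} (hn : topologicalKrullDim X = n)
    (hdim : topologicalKrullDim ↥Z = ((n - 1 : ℕ) : WithBot ℕ∞)) (h1n : 1 ≤ n) : Order.coheight hZ.genericPoint = 1 := by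
  have hgen : IsGenericPoint hZ.genericPoint Z := hZ.closure_genericPoint hcl
  have hsum := coheight_add_height_eq_topologicalKrullDim f hZ.genericPoint
  have hh := topologicalKrullDim_eq_height_of_isGenericPoint hgen
  rw [hn] at hsum
  rw [hdim] at hh
  have hh' : height hZ.genericPoint = ((n - 1 : ℕ) : ℕ∞) := by
    apply WithBot.coe_injective
    rw [← hh]
    norm_cast
  have hsum' : coheight hZ.genericPoint + height hZ.genericPoint = (n : ℕ∞) := by exact_mod_cast hsum
  rw [hh'] at hsum'
  have hfin : coheight hZ.genericPoint ≠ ⊤ := by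
    intro htop
    rw [htop, top_add] at hsum'
    exact ENat.top_ne_coe n hsum'
  obtain ⟨c, hc⟩ := ENat.ne_top_iff_exists.mp hfin
  rw [← hc] at hsum' ⊢
  have : c + (n - 1) = n := by exact_mod_cast hsum'
  have hc1 : c = 1 := by omega
  rw [hc1]
  rfl

end CartierDivisor

/-! ## §2 The prime theta divisor `Θ_W = [W̃_{dim J − 1}(P)]` of a Jacobian -/

namespace Jacobian

variable {k : Type u} [Field k] {C : SchemeOver k} [GeometricallyIrreducible C.hom] (𝒥 : Jacobian C) (P : AlgPoints C k)

/-- **`coheight η_{W̃_r(P)} = 1 ⟸ dim W̃_r(P) = dim J − 1`** (`J` integral of finite type over `k`, `dim J = 𝒥.J.dim` ★ `topologicalKrullDim_left`).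
[cite: GortzWedhorn2020, Thm. 5.22 (3)] [cite: Lange2023AbelianVarietiesComplex, §4.2.1 Lemma 4.2.1 (ii) and Cor. 4.2.4] -/
theorem coheight_genericPoint_brillNoetherLocus_eq_one (hdim : 1 ≤ 𝒥.J.dim) (r : ℕ)
    (hdimW : topologicalKrullDim ↥(𝒥.brillNoetherLocus P r) = ((𝒥.J.dim - 1 : ℕ) : WithBot ℕ∞)) :
    Order.coheight (𝒥.isIrreducible_brillNoetherLocus P r).genericPoint = 1 :=
  CartierDivisor.coheight_genericPoint_eq_one_of_topologicalKrullDim 𝒥.J.X.hom (𝒥.isIrreducible_brillNoetherLocus P r)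
    (𝒥.isClosed_brillNoetherLocus P r) 𝒥.J.topologicalKrullDim_left hdimW hdim

/-- **If SOME Riemann theta divisor exists, `η_{W̃_{g−1}(P)}` has codimension one** (★ p766592 `dim W̃_{g−1}(P) = g − 1` under a theta divisor,
★ p767132 `dim J ≥ 1`). [cite: Lange2023AbelianVarietiesComplex, §4.2.1 Lemma 4.2.1 (ii) and Cor. 4.2.4] -/
theorem coheight_genericPoint_brillNoetherLocus_eq_one_of_isRiemannThetaDivisor {n : ℕ} (hC : IsSmoothProjective n C)
    {Θ : CartierDivisor 𝒥.J.X.left} (h : 𝒥.IsRiemannThetaDivisor Θ) :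
    Order.coheight (𝒥.isIrreducible_brillNoetherLocus P (𝒥.J.dim - 1)).genericPoint = 1 :=
  𝒥.coheight_genericPoint_brillNoetherLocus_eq_one P h.one_le_dim _
    (𝒥.topologicalKrullDim_brillNoetherLocus_of_isRiemannThetaDivisor hC h P)

section Prime

variable (h1 : Order.coheight (𝒥.isIrreducible_brillNoetherLocus P (𝒥.J.dim - 1)).genericPoint = 1)

/-- **The prime theta divisor `Θ_W = [W̃_{dim J−1}(P)]` has support exactly `W̃_{dim J−1}(P)`** (`J` is regular ★ `isRegularLocalRing_stalk`,
integral, Noetherian ★ `isNoetherian_left`). [cite: Lange2023AbelianVarietiesComplex, §4.2.1 Lemma 4.2.1 (ii) and Cor. 4.2.4]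
[cite: Hartshorne1977, II.6 Prop. 6.11 and Remark 6.11.2 (pp. 141–142)] -/
theorem compl_nonvanishing_one_primeTheta :
    letI := 𝒥.J.isNoetherian_left
    ((CartierDivisor.ofIsEffectiveCartier (primeDivisorIdeal (𝒥.isIrreducible_brillNoetherLocus P (𝒥.J.dim - 1)).genericPoint)
      (isEffectiveCartier_primeDivisorIdeal_of_isRegular (fun x => 𝒥.J.isRegularLocalRing_stalk x) h1)).nonvanishing 1)ᶜ =
      𝒥.brillNoetherLocus P (𝒥.J.dim - 1) := by
  letI := 𝒥.J.isNoetherian_left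
  rw [CartierDivisor.compl_nonvanishing_one_prime (fun x => 𝒥.J.isRegularLocalRing_stalk x) h1]
  exact (𝒥.isIrreducible_brillNoetherLocus P _).closure_genericPoint (𝒥.isClosed_brillNoetherLocus P _)

/-- **The prime theta divisor `Θ_W` is a Riemann theta divisor** (effective, support `= t_1(W̃_{dim J−1}(P))`; ★ p767130
`isRiemannThetaDivisor_of_support_eq_brillNoetherLocus`). [cite: Milne1986JacobianVarieties, §6 (Θ = W^{g-1}, before Thm. 6.6)]
[cite: Lange2023AbelianVarietiesComplex, §4.2.1 Cor. 4.2.4] -/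
theorem isRiemannThetaDivisor_primeTheta :
    letI := 𝒥.J.isNoetherian_left
    𝒥.IsRiemannThetaDivisor (CartierDivisor.ofIsEffectiveCartier
      (primeDivisorIdeal (𝒥.isIrreducible_brillNoetherLocus P (𝒥.J.dim - 1)).genericPoint)
      (isEffectiveCartier_primeDivisorIdeal_of_isRegular (fun x => 𝒥.J.isRegularLocalRing_stalk x) h1)) :=
  letI := 𝒥.J.isNoetherian_left
  isRiemannThetaDivisor_of_support_eq_brillNoetherLocus
    (CartierDivisor.isEffective_prime (fun x => 𝒥.J.isRegularLocalRing_stalk x) h1) P (𝒥.compl_nonvanishing_one_primeTheta P h1)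

include h1 in
/-- **Existence of the prime theta divisor, packaged**: given `coheight η_{W̃} = 1` there is an effective Cartier divisor `Θ_W` on `J` which is a
Riemann theta divisor with support EXACTLY `W̃ = W̃_{dim J−1}(P)`, ideal sheaf `𝒪_J(−Θ_W) = vanishingIdeal W̃`, integral closed subscheme
`Z(Θ_W)`, and such that EVERY effective Cartier divisor with support `W̃` is `≈ a • Θ_W` for some `a ≥ 1` (Hartshorne II.6.11 on the regular
`J`).  This is `W̃_{g−1}` «as an effective divisor» of Lange's Cor. 4.2.4 / Milne's `Θ = W^{g−1}`. [cite: Lange2023AbelianVarietiesComplex, §4.2.1 Lemma 4.2.1 (ii) and Cor. 4.2.4]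
[cite: Milne1986JacobianVarieties, §6 (Θ = W^{g-1}, before Thm. 6.6)] [cite: Hartshorne1977, II.6 Prop. 6.11 and Remark 6.11.2 (pp. 141–142)] -/
theorem exists_prime_isRiemannThetaDivisor :
    ∃ (Θ : CartierDivisor 𝒥.J.X.left) (hΘ : Θ.IsEffective), 𝒥.IsRiemannThetaDivisor Θ ∧
      (Θ.nonvanishing 1)ᶜ = 𝒥.brillNoetherLocus P (𝒥.J.dim - 1) ∧
      hΘ.idealSheaf = Scheme.IdealSheafData.vanishingIdeal
        ⟨𝒥.brillNoetherLocus P (𝒥.J.dim - 1), 𝒥.isClosed_brillNoetherLocus P _⟩ ∧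
      IsIntegral hΘ.idealSheaf.subscheme ∧
      ∀ D : CartierDivisor 𝒥.J.X.left, D.IsEffective → (D.nonvanishing 1)ᶜ = 𝒥.brillNoetherLocus P (𝒥.J.dim - 1) →
        ∃ a : ℕ, 0 < a ∧ D.SameDivisor (a • Θ) := by
  letI := 𝒥.J.isNoetherian_left
  have hJ : Scheme.IsRegular 𝒥.J.X.left := fun x => 𝒥.J.isRegularLocalRing_stalk x
  have hgen := (𝒥.isIrreducible_brillNoetherLocus P (𝒥.J.dim - 1)).closure_genericPoint (𝒥.isClosed_brillNoetherLocus P _)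
  refine ⟨_, CartierDivisor.isEffective_prime hJ h1, 𝒥.isRiemannThetaDivisor_primeTheta P h1, 𝒥.compl_nonvanishing_one_primeTheta P h1,
    ?_, CartierDivisor.isIntegral_subscheme_idealSheaf_prime hJ h1, fun D hD hsupp => ?_⟩
  · rw [CartierDivisor.idealSheaf_prime hJ h1, primeDivisorIdeal]
    congr 1
    exact Closeds.ext hgen
  · exact hD.exists_sameDivisor_smul_prime hJ h1 (hsupp.trans hgen.symm)

/-- **A Riemann theta divisor of a PRINCIPAL polarisation with support `W̃_{dim J−1}(P)` IS the prime theta divisor** (same divisor): the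
principality-free content of `h2` on road (E) is «multiplicity one» (★ p766910 `eq_one_of_sameDivisor_smul`), complex Jacobians.
[cite: Lange2023AbelianVarietiesComplex, §4.2.1 Lemma 4.2.1 (ii) and Cor. 4.2.4] -/
theorem sameDivisor_primeTheta_of_isPrincipalPolarizationDivisor {X : SchemeOver ℂ} [GeometricallyIrreducible X.hom] (𝒥 : Jacobian X)
    (P : AlgPoints X ℂ) (h1 : Order.coheight (𝒥.isIrreducible_brillNoetherLocus P (𝒥.J.dim - 1)).genericPoint = 1)
    {Θ₀ : CartierDivisor 𝒥.J.X.left} (h0 : Θ₀.IsEffective) (hsupp : (Θ₀.nonvanishing 1)ᶜ = 𝒥.brillNoetherLocus P (𝒥.J.dim - 1))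
    (hpr : 𝒥.J.IsPrincipalPolarizationDivisor Θ₀) :
    letI := 𝒥.J.isNoetherian_left
    Θ₀.SameDivisor (CartierDivisor.ofIsEffectiveCartier
      (primeDivisorIdeal (𝒥.isIrreducible_brillNoetherLocus P (𝒥.J.dim - 1)).genericPoint)
      (isEffectiveCartier_primeDivisorIdeal_of_isRegular (fun x => 𝒥.J.isRegularLocalRing_stalk x) h1)) := by
  letI := 𝒥.J.isNoetherian_left
  have hgen := (𝒥.isIrreducible_brillNoetherLocus P (𝒥.J.dim - 1)).closure_genericPoint (𝒥.isClosed_brillNoetherLocus P _)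
  have hdim : 1 ≤ 𝒥.J.dim := (isRiemannThetaDivisor_of_support_eq_brillNoetherLocus h0 P hsupp).one_le_dim
  exact h0.sameDivisor_prime_of_forall_eq_one (fun x => 𝒥.J.isRegularLocalRing_stalk x) h1 (hsupp.trans hgen.symm)
    fun E m hm hs => hpr.eq_one_of_sameDivisor_smul hdim E m hm hs

/-! ### (ed. 2) HONE: the prime theta divisor is not a proper multiple of an effective divisor -/

/-- `Z(Θ_W)` is reduced (it is integral, ★ `isIntegral_subscheme_idealSheaf_prime`). [cite: Hartshorne1977, II.6 Prop. 6.11 and Remark 6.11.2 (pp. 141–142)] -/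
theorem isReduced_subscheme_idealSheaf_primeTheta :
    letI := 𝒥.J.isNoetherian_left
    IsReduced (CartierDivisor.isEffective_prime (X := 𝒥.J.X.left) (fun x => 𝒥.J.isRegularLocalRing_stalk x)
      (η := (𝒥.isIrreducible_brillNoetherLocus P (𝒥.J.dim - 1)).genericPoint) h1).idealSheaf.subscheme := by
  letI := 𝒥.J.isNoetherian_left
  haveI := CartierDivisor.isIntegral_subscheme_idealSheaf_prime (X := 𝒥.J.X.left) (fun x => 𝒥.J.isRegularLocalRing_stalk x)
    (η := (𝒥.isIrreducible_brillNoetherLocus P (𝒥.J.dim - 1)).genericPoint) h1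
  infer_instance

/-- **HONE for the prime theta divisor**: `Θ_W = [W̃_{dim J−1}(P)]` is not a proper multiple of an EFFECTIVE divisor — if `Θ_W ≈ m • E` with
`E ≥ 0` and `m ≥ 1` then `m = 1` (`Z(Θ_W)` is reduced with irreducible support, ★ `CartierDivisor.IsEffective.eq_one_of_sameDivisor_smul_of_isReduced`:
`𝓘_{W̃} = 𝓘_{W̃}^{b m}` in the stalk at `η_{W̃}` forces `b m = 1`).  The weak ∕ effective multiplicity-one hypothesis `hone` of the principality-free
Step-I transport (cell road (V7-b)), for the object of interface row VI-7. [cite: Hartshorne1977, II.6 Prop. 6.11 and Remark 6.11.2 (pp. 141–142)]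
[cite: Lange2023AbelianVarietiesComplex, §4.2.1 Lemma 4.2.1 (ii) and Cor. 4.2.4] -/
theorem forall_isEffective_eq_one_primeTheta :
    letI := 𝒥.J.isNoetherian_left
    ∀ (E : CartierDivisor 𝒥.J.X.left) (m : ℕ), E.IsEffective → 0 < m →
      (CartierDivisor.ofIsEffectiveCartier (primeDivisorIdeal (𝒥.isIrreducible_brillNoetherLocus P (𝒥.J.dim - 1)).genericPoint)
        (isEffectiveCartier_primeDivisorIdeal_of_isRegular (fun x => 𝒥.J.isRegularLocalRing_stalk x) h1)).SameDivisor (m • E) → m = 1 := by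
  letI := 𝒥.J.isNoetherian_left
  intro E m hE hm h
  haveI := 𝒥.isReduced_subscheme_idealSheaf_primeTheta P h1
  have hirr : IsIrreducible ((CartierDivisor.ofIsEffectiveCartier
      (primeDivisorIdeal (𝒥.isIrreducible_brillNoetherLocus P (𝒥.J.dim - 1)).genericPoint)
      (isEffectiveCartier_primeDivisorIdeal_of_isRegular (fun x => 𝒥.J.isRegularLocalRing_stalk x) h1)).nonvanishing 1)ᶜ := by
    rw [𝒥.compl_nonvanishing_one_primeTheta P h1]
    exact 𝒥.isIrreducible_brillNoetherLocus P _
  exact (CartierDivisor.isEffective_prime (fun x => 𝒥.J.isRegularLocalRing_stalk x) h1).eq_one_of_sameDivisor_smul_of_isReduced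
    (fun x => 𝒥.J.isRegularLocalRing_stalk x) hirr hE hm h

end Prime

end Jacobian

end Literature.AlgebraicGeometry.Motives

end
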